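import Summits.QuantumFields.BalabanUV.T4Continuum.Support.B13OpDatumJunctions
import Summits.QuantumFields.BalabanUV.T4Continuum.Spine.NE2BalabanDecayRate

/-!
# T⁴ programme — THE JUNCTION NE5(O1-b) ⇐ NE2(tier B, sub-row Δ3): row NE5's ENTRY-CURRENCY socket `LevelEntryRate` (consecutive
# levels, weighted entries — the shape of `T4EtaRate.EtaRateIneqUnit`) fed BY NAME by ROOT B's decay stations, with the decay
# format `wt(x,y) = e^{−δ′·dist(x,y)}`, modulo the displayed uniform-decay binder `hdec`

Eleventh generation of the NE2 prover lineage P1 of the cell `pub-balaban` (row NE2 owner), file 7.  The NE5 crew typed two sockets through which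
node U3 consumes row NE2's two-run objects: the OPERATOR-NORM carrier law `OutputRateTowerSocket.TowerLaw` (W1; fed by ROOT B in
`Support/OutputRateTowerBalaban`, leaf-08-g2) and the ENTRY-CURRENCY shapes `B13OpDatumJunctions.LevelEntryRate` / `WeightedEntrywiseRate`
(row O1-b, leaf-07 of the NE5 crew: «row NE2's two-run object in ENTRY currency — the shape of `T4EtaRate.EtaRateIneqUnit`,
`|Kd(y,y′)| ≤ B₀·e^{−δ₀d(y,y′)}·θ^k`» against format weights `wt e`).  The second socket is exactly what sub-row Δ3 produces:

 * §1 `decayFormat dist δ′ : Format (n × n)` — the weight `e^{−δ′·dist(x,y)}` on the entry `(x,y)` (positive); **`levelEntryRate_of_twoLevelDecayRate`**: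
   a family of towers `ker g U` (any window set `W`, any background type) each obeying `DecayRateInterpolation.TwoLevelDecayRate dist (ker g U) B δ′ θ`
   IS a `LevelEntryRate (fun _ => decayFormat dist δ′) … W B (k ↦ θ^k)` (one line: `‖a − b‖ = ‖b − a‖`).
 * §2 **`levelEntryRate_balaban_final_of_regular`** — for a FAMILY of site-based colour-transporter data `Rg U` (DATA, indexed by an arbitrary
   background type; no B0) with COMMON sizes in row B5's (3.35)-shape class, node NE3's `LocalRate … C L⁻¹` BY NAME per member (OPEN), `a′ > 0`,
   `α, β ≤ η ≤ etaStar`, and a COMMON level-uniform entry decay `hdec` of the unit-lattice covariances `pertCovC (P_B U) 1 k` (displayed; printed KIND):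
   NE5's socket `LevelEntryRate (fun _ => decayFormat dist (δ/2)) (fun _ U k e => pertCovC (P_B U) 1 k e.1 e.2) W √(2B·2C_B(1)/(1−L⁻¹)) (k ↦ (√(L⁻¹))^k)`
   holds — `NE2BalabanDecayRate.balaban_final_decayStations_of_regular` composed with §1, every binder passed through VERBATIM; and the
   `WeightedEntrywiseRate` form for the two runs «k levels / k+1 levels» (`weightedEntrywiseRate_balaban_final_of_regular`, via the crew's
   `weightedEntrywiseRate_of_levels`).

So on the typed spine BOTH U3 sockets that read row NE2 are now fed by name from ROOT B: W1 in operator norm (no decay needed), O1-b in the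
weighted entry currency modulo `hdec` (sub-row Δ3).  Which of the two the step model of record uses is row NE5's business.

HONEST FRAMING (T4-DAG p. 1).  Junction bookkeeping; `Rg` DATA (no B0); `hreg`, `hNE3` (node NE3, OPEN), the threshold and `hdec` DISPLAYED per
member; the format/raw-supplier typing of row O1-b is untouched (only its hypothesis SHAPE is instantiated); NE5 NOT proved, NE2 NOT proved, NE3
NOT proved; model level, global small field, finite torus, linear layer; spine PROVED 0/9 unchanged; NOT infinite volume / mass gap / Clay.
HONEST DEPENDENCY: continuum YM on T⁴ ⇐ BetaPertH ∧ nine spine estimates (0/9 proved); BetaPertH ⇐ (D1) ∧ (D4) ∧ CAP+tail; G-an2-4 gates asym, D1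
and NE2/3/4.  ABSOLUTE RULE kept; one `def` (the decay format); no `sorry`.
-/

noncomputable section

open scoped BigOperators ComplexConjugate Matrix Matrix.Norms.L2Operator Kronecker

namespace Summit.QuantumFields.BalabanUV.T4Continuum.OutputRateDecayBalaban

open Literature.MathematicalPhysics.QuantumFieldTheory.Balaban1983to89.B5Prop11Plancherel (Cst Cst_nonneg Tor fine)
open Literature.MathematicalPhysics.QuantumFieldTheory.Balaban1983to89.B5G183RateUnitTower (lev lev_neZero)
open Literature.MathematicalPhysics.QuantumFieldTheory.Balaban1983to89.T4EtaRateMin (LocalRate)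
open Summit.QuantumFields.BalabanUV.T4Continuum
open Summit.QuantumFields.BalabanUV.T4Continuum.BalabanAveragedTowerUnit (idx Qlev)
open Summit.QuantumFields.BalabanUV.T4Continuum.BackgroundResolventTower
open Summit.QuantumFields.BalabanUV.T4Continuum.KingPairingPlantedLaw
open Summit.QuantumFields.BalabanUV.T4Continuum.GramPerturbationLaw (C2gram)
open Summit.QuantumFields.BalabanUV.T4Continuum.NE2FromNE3 (bgReadings)
open Summit.QuantumFields.BalabanUV.T4Continuum.NE2ColourPerturbedLayer (pertCovC pertLimC)
open Summit.QuantumFields.BalabanUV.T4Continuum.RegularBackgroundTower (RegularTransporters regClass betaNE3)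
open Summit.QuantumFields.BalabanUV.T4Continuum.GaugeTermScalarData (QuT Q1)
open Summit.QuantumFields.BalabanUV.T4Continuum.RegularSiteTransporters (siteT)
open Summit.QuantumFields.BalabanUV.T4Continuum.NestedContourTransport (theta0)
open Summit.QuantumFields.BalabanUV.T4Continuum.NE2BalabanRoot (balabanPert)
open Summit.QuantumFields.BalabanUV.T4Continuum.NE2BalabanGauge (gaugeSlot liftR)
open Summit.QuantumFields.BalabanUV.T4Continuum.NE2BalabanLayerSharp (kappaBs C2Bs)
open Summit.QuantumFields.BalabanUV.T4Continuum.NE2BalabanWiring (epsR CdeltaR)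
open Summit.QuantumFields.BalabanUV.T4Continuum.NE2BalabanFinal (kappa4F C4F)
open Summit.QuantumFields.BalabanUV.T4Continuum.NE2BalabanThreshold (etaStar)
open Summit.QuantumFields.BalabanUV.T4Continuum.DecayRateInterpolation (EntryDecay DecayRate TwoLevelDecayRate)
open Summit.QuantumFields.BalabanUV.T4Continuum.NE2BalabanDecayRate (balaban_final_decayStations_of_regular)
open Summit.QuantumFields.BalabanUV.T4Continuum.B13OpDatum (Format)
open Summit.QuantumFields.BalabanUV.T4Continuum.B13OpDatumJunctions (LevelEntryRate WeightedEntrywiseRate weightedEntrywiseRate_of_levels)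

/-! ## §1 The decay format and the generic junction -/

section Generic

variable {n Bg : Type*}

/-- THE DECAY FORMAT on pairs of unit-lattice sites: weight `e^{−δ′·dist(x,y)}` on the entry `(x,y)` (row O1-b's `Format`, positive weights).
[folklore] -/
def decayFormat (dist : n → n → ℝ) (δ' : ℝ) : Format (n × n) where
  wt e := Real.exp (-(δ' * dist e.1 e.2))
  wt_pos _ := Real.exp_pos _

/-- **Δ3's two-level shape IS NE5's consecutive-level entry socket**: towers `ker g U` each with `TwoLevelDecayRate dist (ker g U) B δ′ θ` give
`LevelEntryRate (fun _ => decayFormat dist δ′) (fun g U k e => ker g U k e.1 e.2) W B (k ↦ θ^k)`. [folklore] -/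
theorem levelEntryRate_of_twoLevelDecayRate {dist : n → n → ℝ} {ker : (ℕ → ℝ) → Bg → ℕ → Matrix n n ℂ} {W : Set (ℕ → ℝ)}
    {B δ' θ : ℝ} (h : ∀ g ∈ W, ∀ U : Bg, TwoLevelDecayRate dist (ker g U) B δ' θ) :
    LevelEntryRate (fun _ => decayFormat dist δ') (fun g U k e => ker g U k e.1 e.2) W B (fun k => θ ^ k) := by
  intro k g hg U e
  rw [norm_sub_rev, ← Matrix.sub_apply]
  exact h g hg U k e.1 e.2

/-- … and the two-run form «run A reads `k+1` levels, run B reads `k` levels» (`WeightedEntrywiseRate`, the crew's `weightedEntrywiseRate_of_levels`).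
[folklore] -/
theorem weightedEntrywiseRate_of_twoLevelDecayRate {dist : n → n → ℝ} {ker : (ℕ → ℝ) → Bg → ℕ → Matrix n n ℂ} {W : Set (ℕ → ℝ)}
    {B δ' θ : ℝ} (h : ∀ g ∈ W, ∀ U : Bg, TwoLevelDecayRate dist (ker g U) B δ' θ) :
    WeightedEntrywiseRate (fun _ => decayFormat dist δ') (fun g U k e => ker g U k e.1 e.2) (fun g U k e => ker g U (k + 1) e.1 e.2) W B
      (fun k => θ ^ k) :=
  weightedEntrywiseRate_of_levels (levelEntryRate_of_twoLevelDecayRate h)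

end Generic

/-! ## §2 ROOT B feeds NE5's entry-currency socket (modulo `hdec`) -/

variable {d : ℕ} (L : ℕ) [NeZero L] (M : Fin d → ℕ) [hM : ∀ μ, NeZero (M μ)] (a : ℝ) (ha : 0 < a)
variable {o : Type*} [Fintype o] [DecidableEq o] {Bg : Type*}

/-- **THE JUNCTION NE5(O1-b) ⇐ NE2(tier B) IN THE DECAY CURRENCY** (`L ≥ 2`, `d ≥ 1`, `a′ > 0`): for a family `U ↦ Rg U` of site-based bond transporter
data in row B5's (3.35)-shape class with common sizes `α, β ≤ η ≤ etaStar`, node NE3's `LocalRate … C L⁻¹` BY NAME for every member (OPEN), and a common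
level-uniform entry decay `hdec` of the unit-lattice covariances `pertCovC (P_B U) 1 k` against `dist` (displayed; the printed KIND), NE5's
consecutive-level entry socket holds with the decay format `e^{−(δ/2)dist}`, constant `√(2B·2C_B(1)/(1−L⁻¹))` and rate `(√(L⁻¹))^k` — ROOT B's decay
stations BY NAME.  Model level (no B0); CONDITIONAL on NE3 + the (3.35)-class + the threshold + `hdec`; neither NE2 nor NE5 is proved by this.
[cite: King1986, Lemma 4.5 (4.38) p.674 (shape); Balaban1985BackgroundPropagators, (3.26) p.395, (3.35) p.396, Thm 3.4 p.400 (shapes)] [folklore] -/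
theorem levelEntryRate_balaban_final_of_regular (hL : 2 ≤ L) (hd : 1 ≤ d)
    {Rg : Bg → (k : ℕ) → Fin d → (Tor (fine (lev L k) M) → Matrix o o ℂ)}
    {α β : ℝ} (hreg : ∀ U, RegularTransporters L M (liftR L M (Rg U)) α β) {C : ℝ} (hC : 0 ≤ C)
    (hNE3 : ∀ U, LocalRate (bgReadings L M (regClass L M (liftR L M (Rg U)))) C ((L : ℝ)⁻¹)) {a' : ℝ} (ha' : 0 < a')
    {η : ℝ} (hαη : α ≤ η) (hβη : β ≤ η) (hη : η ≤ etaStar o d a a')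
    {dist : idx L M 0 × o → idx L M 0 × o → ℝ} {B δ : ℝ}
    (hdec : ∀ U k, EntryDecay dist
      (pertCovC L M a ha (balabanPert L M a (liftR L M (Rg U)) (gaugeSlot L M (Rg U) (QuT L M o (siteT L M (Rg U))) (Q1 L M o) a')) 1 k) B δ)
    (W : Set (ℕ → ℝ)) :
    LevelEntryRate (fun _ => decayFormat dist (δ / 2))
      (fun (_ : ℕ → ℝ) (U : Bg) (k : ℕ) (e : (idx L M 0 × o) × (idx L M 0 × o)) =>
        pertCovC L M a ha (balabanPert L M a (liftR L M (Rg U)) (gaugeSlot L M (Rg U) (QuT L M o (siteT L M (Rg U))) (Q1 L M o) a')) 1 k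
          e.1 e.2)
      W
      (Real.sqrt (2 * B * (2 *
          Cpert (kappaBs o d a α β (a * (epsR o d α * (2 + epsR o d α) * Cst d a)) (kappa4F d a a' α β)) (2 * d * Cst d a) (CJ d a)
              (C2Bs o d L a α β C
                (a * C2gram (Cst d a) 1 (epsR o d α) (2 * d * Cst d a) (CJ d a) (Cst d a) (CdeltaR o d a α (theta0 d α (betaNE3 o C))))
                (C4F o d L a a' α β C)) 0 1 / (1 - (L : ℝ)⁻¹))))
      (fun k => Real.sqrt ((L : ℝ)⁻¹) ^ k) := by
  have h1 : ‖(1 : ℂ)‖ ≤ 1 := by rw [norm_one]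
  refine levelEntryRate_of_twoLevelDecayRate fun _ _ U => ?_
  exact (balaban_final_decayStations_of_regular L M a ha hL hd (hreg U) hC (hNE3 U) ha' hαη hβη hη h1 (hdec U)).2.2

/-- … and the two-run form (`WeightedEntrywiseRate`, run A = `k+1` levels, run B = `k` levels). [folklore] -/
theorem weightedEntrywiseRate_balaban_final_of_regular (hL : 2 ≤ L) (hd : 1 ≤ d)
    {Rg : Bg → (k : ℕ) → Fin d → (Tor (fine (lev L k) M) → Matrix o o ℂ)}
    {α β : ℝ} (hreg : ∀ U, RegularTransporters L M (liftR L M (Rg U)) α β) {C : ℝ} (hC : 0 ≤ C)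
    (hNE3 : ∀ U, LocalRate (bgReadings L M (regClass L M (liftR L M (Rg U)))) C ((L : ℝ)⁻¹)) {a' : ℝ} (ha' : 0 < a')
    {η : ℝ} (hαη : α ≤ η) (hβη : β ≤ η) (hη : η ≤ etaStar o d a a')
    {dist : idx L M 0 × o → idx L M 0 × o → ℝ} {B δ : ℝ}
    (hdec : ∀ U k, EntryDecay dist
      (pertCovC L M a ha (balabanPert L M a (liftR L M (Rg U)) (gaugeSlot L M (Rg U) (QuT L M o (siteT L M (Rg U))) (Q1 L M o) a')) 1 k) B δ)
    (W : Set (ℕ → ℝ)) :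
    WeightedEntrywiseRate (fun _ => decayFormat dist (δ / 2))
      (fun (_ : ℕ → ℝ) (U : Bg) (k : ℕ) (e : (idx L M 0 × o) × (idx L M 0 × o)) =>
        pertCovC L M a ha (balabanPert L M a (liftR L M (Rg U)) (gaugeSlot L M (Rg U) (QuT L M o (siteT L M (Rg U))) (Q1 L M o) a')) 1 k
          e.1 e.2)
      (fun (_ : ℕ → ℝ) (U : Bg) (k : ℕ) (e : (idx L M 0 × o) × (idx L M 0 × o)) =>
        pertCovC L M a ha (balabanPert L M a (liftR L M (Rg U)) (gaugeSlot L M (Rg U) (QuT L M o (siteT L M (Rg U))) (Q1 L M o) a')) 1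
          (k + 1) e.1 e.2)
      W
      (Real.sqrt (2 * B * (2 *
          Cpert (kappaBs o d a α β (a * (epsR o d α * (2 + epsR o d α) * Cst d a)) (kappa4F d a a' α β)) (2 * d * Cst d a) (CJ d a)
              (C2Bs o d L a α β C
                (a * C2gram (Cst d a) 1 (epsR o d α) (2 * d * Cst d a) (CJ d a) (Cst d a) (CdeltaR o d a α (theta0 d α (betaNE3 o C))))
                (C4F o d L a a' α β C)) 0 1 / (1 - (L : ℝ)⁻¹))))
      (fun k => Real.sqrt ((L : ℝ)⁻¹) ^ k) :=
  weightedEntrywiseRate_of_levels (levelEntryRate_balaban_final_of_regular L M a ha hL hd hreg hC hNE3 ha' hαη hβη hη hdec W)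

end Summit.QuantumFields.BalabanUV.T4Continuum.OutputRateDecayBalaban

end
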